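import Mathlib.Analysis.Complex.ExponentialBounds

/-!
# NE9CubeCurrencyBudget — the CUBE-CURRENCY BUDGET of the typed dischargers of row NE9's END: kernel-exact NECESSARY
conditions read off the numeric binder SHAPES of road P2's cube-chart faces (cell `pub-balaban`, node U3 / spine estimate
NE9, rung (B)+1 on a FIXED finite T⁴; NE9 formalisation crew, unit `b2b-balaban-t4-ne9-formalise-leaf-01`, census item
«N2-bis», companion of the N2 census `NE9FadingArithmetic` / `NE9FadingCensus.md` of leaf-10)

HONEST FRAMING (T4-DAG PAGE 1).  Rung (B)+1 on a fixed finite torus; NOT infinite volume, NOT the mass gap, NOT Clay.  NE9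
is NOT PRINTED and NOT proved; this module is OUR OWN bookkeeping (pure real arithmetic), asserts nothing about Bałaban's
objects, re-wires no END face and introduces no `def`.  HONEST DEPENDENCY: continuum YM on T⁴ ⇐ BetaPertH ∧ nine spine
estimates (0/9 proved); BetaPertH ⇐ (D1) ∧ (D4) ∧ CAP+tail; G-an2-4 gates asym, D1 and NE2/3/4.

WHAT IS RECORDED.  The row's root face `NE9LastCouplingBridge.ne9_and_fadingMemory_of_couplingTwoPoint` (END-B) takes the
Kotecký–Preiss / geometry binders `TwoPointKP` (A1), `DecayExtract` (G1), `PinBudget` (G2) and the Lipschitz scale `lip`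
ABSTRACTLY; the tree's only PRODUCERS of these binders are road P2's CUBE-COUNT producers, composed in the faces
E2 `T4HistoryLipschitzLinearSize.torus_ne9_and_fadingMemory_of_linSizeDecay` and E5
`NE9PrintedMajorantDecay.torus_ne9_and_fadingMemory_of_printedDecay`, whose numeric binders read (verbatim shapes, `ν` =
torus dimension, `D` = wall-adjacency degree, decay weights `d₁` PER CUBE, `d X ≤ #cubes X`):
* `hθ    : 2 * exp (-(a' / 2 ^ ν)) * exp (a₁ + d₁) * exp (D * θ) ≤ θ`   (KP entropy vs the per-cube decay left over
  after F5's conversion `ε′·e^{−a′·linSize} ≤ (ε′e^{a′})·(e^{−a′/2^ν})^{#cubes}` of the (2.38)-TYPE majorant decay),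
* `hεθ   : 2 * (ε' * exp a') * θ * (D + 1) ≤ a₁`                        (KP smallness; `a₁` = the pin budget `B` of END-B),
* `hκd   : κ ≤ d₁`                                                       (the NE9 rate is extracted per cube),
* `hθ₁   : exp (-(a / 2 ^ ν)) * exp (D * θ₁) ≤ θ₁`, `hliplb : α4 * exp a * θ₁ ≤ lip k`, `hlipb : lip k ≤ lipbar`
  (the pinned coefficient sum — (1.26)-TYPE — in cube currency),
and whose memory rate is `ω + 4·lipbar·a₁·τ̄` (fading iff `< 1`, `T4HistoryLipschitzSegment.fade_iff`).
From these SHAPES alone (§2–§3, hypotheses copied token for token):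
(R) RATE DIVISION   `κ ≤ a′/2^ν − a₁ − 1 − log(2D)`; on T⁴ (ν = 4, D = 8): `κ < a′/16 − 3.77`.
(P) FADING PRODUCT  `lipbar ≥ α4·e^{a(1−2^{−ν})}`, `a₁ ≥ 4(D+1)·ε′·e^{a′(1−2^{−ν})+κ}`, hence a fading rate REQUIRES
    `16(D+1)·α4·ε′·τ̄·exp(a(1−2^{−ν}) + a′(1−2^{−ν}) + κ) < 1 − ω`.
§4 reads (R)/(P) in print's letters under the lineages' LOCATED dictionary (a READING, not a printed statement):
`a ↔ δκ` ((2.18)×(1.36) = the (2.20) summand «α₄exp(−δκd_k(Y))», [II] p. 16), `a′ ↔ (1−8δ)½L·κ` ((2.38) p. 20),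
`δ = (1 − 2L⁻¹)/10` (p. 21 «(1 − 10δ)½L = 1»): (R) becomes `κ_NE9 < (L+8)κ/160` (full printed rate only for L ≥ 152) and the
exponent of (P) is `X(L)·κ`, `X(L) = (3L + 59)/32 − 3/(16L)`, against the `e^{−5κ}` that print's ε₁-smallness carries
(p. 18 «2E₀ε₁C₁α₄⁻¹α₆⁻¹M^q exp C₂κ₁ exp 5κ ≤ 1», p. 21): `X(33) < 5 < X(35)` (`norm_num`).
CENSUS MEANING.  Leaf-10's verdict («fading is not an additional ε₁-smallness; it follows from p. 20/p. 21 once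
M⁴ > 648Kc⋆/(1 − L⁻¹)», `NE9FadingArithmetic.fade_of_printed`) holds for END-B's ABSTRACT letters under the print-currency
dictionary (c″ = print's (1.26)/(2.20) «O(1)α₄»); through the TYPED dischargers the same letters carry `e^{a+a′}` and the
delivered rate is divided by `2^ν` — artefacts of PER-CUBE decay weights and the cube-count lattice-animal bound, NOT of the
mathematics: print's chain and the cell's kernel B13 chain (`B13Resummation`, (1.26) in d-currency
`B12Ext436Lattice.ineq126_latt` with ADDITIVE threshold `κ ≥ κ₀(4·2^d, 2d)` and constant `K₀`) lose only additively.
REPAIR (offered as crew item F8, not done here): d-currency `DecayExtract` with weights `a″·(linSize + ν + 1)` from P2's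
certified (2.27) `linSize_biUnion_add_le_sum` (the «+ν+1» per member is print's «(d_k(Y)+5)», the source of the `e^{5κ}`),
and the KP clause / pinned sums from the d-currency (1.26).

References (TYPE locators only; nothing printed is a hypothesis): T. Bałaban, CMP **116** (1988) 1–22 [Balaban1988RG2Cluster],
(1.26) p. 8, (2.18)–(2.20) p. 16, (2.27) p. 18, (2.30) p. 18, Lemma 3 (2.38) p. 20, p. 21; R. Kotecký, D. Preiss, CMP **103**
(1986) 491–498.
-/

noncomputable section

namespace Summit.QuantumFields.BalabanUV.T4Continuum.NE9CubeCurrencyBudget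

open Real

/-! ## §1 Two elementary inequalities -/

/-- `log θ − Dθ ≤ −1 − log D` for `θ, D > 0` (the maximum of `θ ↦ log θ − Dθ` is at `θ = 1/D`). [folklore] -/
theorem log_sub_mul_le {θ D : ℝ} (hθ : 0 < θ) (hD : 0 < D) : Real.log θ - D * θ ≤ -1 - Real.log D := by
  have h := Real.log_le_sub_one_of_pos (mul_pos hD hθ)
  rw [Real.log_mul hD.ne' hθ.ne'] at h
  linarith

/-- `1 + log 16 > 3.77` (`log 2 > 0.6931471803`). [folklore] -/
theorem one_add_log_sixteen_gt : (3.77 : ℝ) < 1 + Real.log 16 := by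
  have h2 := Real.log_two_gt_d9
  have h16 : Real.log 16 = 4 * Real.log 2 := by
    rw [show (16 : ℝ) = 2 ^ 4 by norm_num, Real.log_pow]; norm_num
  rw [h16]; linarith

/-! ## §2 (R) THE RATE DIVISION forced by the entropy binder `hθ` and `hκd` -/

/-- **(R) RATE BUDGET.**  From the binder shapes `hθ : 2·e^{−a′/2^ν}·e^{a₁+d₁}·e^{Dθ} ≤ θ` (E2/E5's KP entropy condition,
per-cube decay `e^{−a′/2^ν}` after F5's conversion) and `hκd : κ ≤ d₁` with `1 ≤ D`:
`κ ≤ a′/2^ν − a₁ − 1 − log(2D)` — the NE9 decay rate deliverable through the cube-count dischargers is at most the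
(2.38)-TYPE rate `a′` DIVIDED BY `2^ν`, minus an additive constant. [folklore] -/
theorem rate_budget {ν D : ℕ} {a' a₁ d₁ θ κ : ℝ} (hD : 1 ≤ D) (hκd : κ ≤ d₁)
    (hθ : 2 * Real.exp (-(a' / 2 ^ ν)) * Real.exp (a₁ + d₁) * Real.exp (D * θ) ≤ θ) :
    κ ≤ a' / 2 ^ ν - a₁ - 1 - Real.log (2 * D) := by
  have hDpos : (0 : ℝ) < D := by exact_mod_cast hD
  have hlhs : 0 < 2 * Real.exp (-(a' / 2 ^ ν)) * Real.exp (a₁ + d₁) * Real.exp (D * θ) := by positivity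
  have hθpos : 0 < θ := hlhs.trans_le hθ
  -- take logarithms
  have hlog := Real.log_le_log hlhs hθ
  rw [Real.log_mul (by positivity) (Real.exp_pos _).ne', Real.log_mul (by positivity) (Real.exp_pos _).ne',
    Real.log_mul (by norm_num) (Real.exp_pos _).ne', Real.log_exp, Real.log_exp, Real.log_exp] at hlog
  have hmax := log_sub_mul_le hθpos hDpos
  rw [Real.log_mul (by norm_num) hDpos.ne']
  linarith

/-- (R) on T⁴: `ν = 4` (so `2^ν = 16`), wall-adjacency degree `D = 8`: `κ < a′/16 − 3.77 − a₁ ≤ a′/16 − 3.77`. [folklore] -/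
theorem rate_budget_T4 {a' a₁ d₁ θ κ : ℝ} (ha₁ : 0 ≤ a₁) (hκd : κ ≤ d₁)
    (hθ : 2 * Real.exp (-(a' / 2 ^ (4 : ℕ))) * Real.exp (a₁ + d₁) * Real.exp (((8 : ℕ) : ℝ) * θ) ≤ θ) :
    κ < a' / 16 - 3.77 := by
  have h := rate_budget (ν := 4) (D := 8) (by norm_num) hκd hθ
  have h16 := one_add_log_sixteen_gt
  have e : Real.log (2 * ((8 : ℕ) : ℝ)) = Real.log 16 := by norm_num
  rw [e] at h
  have e2 : (2 : ℝ) ^ (4 : ℕ) = 16 := by norm_num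
  rw [e2] at h
  linarith

/-! ## §3 (P) THE FADING PRODUCT forced by `hliplb`/`hθ₁` (Lipschitz scale) and `hεθ`/`hθ` (pin budget) -/

/-- Lower bound of the Lipschitz scale: `hθ₁ : e^{−a/2^ν}·e^{Dθ₁} ≤ θ₁` and `hliplb : α4·e^{a}·θ₁ ≤ lip ≤ lipbar` give
`α4·e^{a(1 − 2^{−ν})} ≤ lipbar` — the cube-currency pinned coefficient sum charges `e^{a}` up to the fraction `2^{−ν}`.
[folklore] -/
theorem lipbar_lb {ν D : ℕ} {a α4 θ₁ lip lipbar : ℝ} (hα4 : 0 ≤ α4)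
    (hθ₁ : Real.exp (-(a / 2 ^ ν)) * Real.exp (D * θ₁) ≤ θ₁) (hliplb : α4 * Real.exp a * θ₁ ≤ lip)
    (hlipb : lip ≤ lipbar) : α4 * Real.exp (a * (1 - 1 / 2 ^ ν)) ≤ lipbar := by
  have hθ₁pos : 0 < θ₁ := lt_of_lt_of_le (by positivity) hθ₁
  have hD0 : (0 : ℝ) ≤ D * θ₁ := mul_nonneg (Nat.cast_nonneg _) hθ₁pos.le
  have h1 : Real.exp (-(a / 2 ^ ν)) ≤ θ₁ := by
    calc Real.exp (-(a / 2 ^ ν)) = Real.exp (-(a / 2 ^ ν)) * 1 := (mul_one _).symm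
      _ ≤ Real.exp (-(a / 2 ^ ν)) * Real.exp (D * θ₁) :=
          mul_le_mul_of_nonneg_left (Real.one_le_exp hD0) (Real.exp_pos _).le
      _ ≤ θ₁ := hθ₁
  have h2 : Real.exp (a * (1 - 1 / 2 ^ ν)) = Real.exp a * Real.exp (-(a / 2 ^ ν)) := by
    rw [← Real.exp_add]; congr 1; ring
  calc α4 * Real.exp (a * (1 - 1 / 2 ^ ν)) = α4 * Real.exp a * Real.exp (-(a / 2 ^ ν)) := by rw [h2, mul_assoc]
    _ ≤ α4 * Real.exp a * θ₁ := mul_le_mul_of_nonneg_left h1 (by positivity)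
    _ ≤ lipbar := hliplb.trans hlipb

/-- Lower bound of the pin budget: `hθ` (with `0 ≤ a₁`, `κ ≤ d₁`) gives `θ ≥ 2e^{−a′/2^ν}e^{κ}`, and then
`hεθ : 2(ε′e^{a′})θ(D+1) ≤ a₁` gives `4(D+1)·ε′·e^{a′(1−2^{−ν}) + κ} ≤ a₁` — the cube-currency KP smallness charges the
pin budget `e^{a′}` (up to the fraction `2^{−ν}`) and `e^{κ}`. [folklore] -/
theorem budget_lb {ν D : ℕ} {a' ε' θ a₁ d₁ κ : ℝ} (hε' : 0 ≤ ε') (ha₁ : 0 ≤ a₁) (hκd : κ ≤ d₁)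
    (hθ : 2 * Real.exp (-(a' / 2 ^ ν)) * Real.exp (a₁ + d₁) * Real.exp (D * θ) ≤ θ)
    (hεθ : 2 * (ε' * Real.exp a') * θ * ((D : ℝ) + 1) ≤ a₁) :
    4 * ((D : ℝ) + 1) * ε' * Real.exp (a' * (1 - 1 / 2 ^ ν) + κ) ≤ a₁ := by
  have hlhs : 0 < 2 * Real.exp (-(a' / 2 ^ ν)) * Real.exp (a₁ + d₁) * Real.exp (D * θ) := by positivity
  have hθpos : 0 < θ := hlhs.trans_le hθ
  have hDθ : (0 : ℝ) ≤ D * θ := mul_nonneg (Nat.cast_nonneg _) hθpos.le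
  -- θ ≥ 2 e^{-a'/2^ν} e^{κ}
  have hθlb : 2 * Real.exp (-(a' / 2 ^ ν)) * Real.exp κ ≤ θ := by
    calc 2 * Real.exp (-(a' / 2 ^ ν)) * Real.exp κ
        ≤ 2 * Real.exp (-(a' / 2 ^ ν)) * Real.exp (a₁ + d₁) * Real.exp (D * θ) := by
          have h1 : Real.exp κ ≤ Real.exp (a₁ + d₁) := Real.exp_le_exp.2 (by linarith)
          have h2 : (1 : ℝ) ≤ Real.exp (D * θ) := Real.one_le_exp hDθ
          calc 2 * Real.exp (-(a' / 2 ^ ν)) * Real.exp κ = 2 * Real.exp (-(a' / 2 ^ ν)) * Real.exp κ * 1 :=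
                (mul_one _).symm
            _ ≤ 2 * Real.exp (-(a' / 2 ^ ν)) * Real.exp (a₁ + d₁) * Real.exp (D * θ) :=
                mul_le_mul (mul_le_mul_of_nonneg_left h1 (by positivity)) h2 zero_le_one (by positivity)
      _ ≤ θ := hθ
  have hc : 0 ≤ 2 * (ε' * Real.exp a') * ((D : ℝ) + 1) := by positivity
  have e : Real.exp (a' * (1 - 1 / 2 ^ ν) + κ) = Real.exp a' * Real.exp (-(a' / 2 ^ ν)) * Real.exp κ := by
    rw [← Real.exp_add, ← Real.exp_add]; congr 1; ring
  calc 4 * ((D : ℝ) + 1) * ε' * Real.exp (a' * (1 - 1 / 2 ^ ν) + κ)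
      = 2 * (ε' * Real.exp a') * ((D : ℝ) + 1) * (2 * Real.exp (-(a' / 2 ^ ν)) * Real.exp κ) := by rw [e]; ring
    _ ≤ 2 * (ε' * Real.exp a') * ((D : ℝ) + 1) * θ := mul_le_mul_of_nonneg_left hθlb hc
    _ = 2 * (ε' * Real.exp a') * θ * ((D : ℝ) + 1) := by ring
    _ ≤ a₁ := hεθ

/-- **(P) THE FADING PRODUCT IN CUBE CURRENCY.**  Under the binder shapes of E2/E5 (`hθ₁`, `hliplb`, `hlipb`, `hθ`, `hεθ`,
`hκd`, signs), the history-memory increment satisfies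
`16(D+1)·α4·ε′·τ̄·exp(a(1−2^{−ν}) + a′(1−2^{−ν}) + κ) ≤ 4·lipbar·a₁·τ̄`; hence a FADING rate
(`ω + 4·lipbar·a₁·τ̄ < 1`) REQUIRES the left side to be `< 1 − ω` — an `ε′τ̄`-smallness EXPONENTIAL in `a`, `a′`, `κ`.
[folklore] -/
theorem fadingProduct_lb {ν D : ℕ} {a a' α4 ε' θ θ₁ a₁ d₁ κ lip lipbar τbar : ℝ} (hα4 : 0 ≤ α4) (hε' : 0 ≤ ε')
    (hτbar : 0 ≤ τbar) (ha₁ : 0 ≤ a₁) (hκd : κ ≤ d₁)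
    (hθ₁ : Real.exp (-(a / 2 ^ ν)) * Real.exp (D * θ₁) ≤ θ₁) (hliplb : α4 * Real.exp a * θ₁ ≤ lip)
    (hlipb : lip ≤ lipbar)
    (hθ : 2 * Real.exp (-(a' / 2 ^ ν)) * Real.exp (a₁ + d₁) * Real.exp (D * θ) ≤ θ)
    (hεθ : 2 * (ε' * Real.exp a') * θ * ((D : ℝ) + 1) ≤ a₁) :
    16 * ((D : ℝ) + 1) * α4 * ε' * τbar * Real.exp (a * (1 - 1 / 2 ^ ν) + a' * (1 - 1 / 2 ^ ν) + κ) ≤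
      4 * lipbar * a₁ * τbar := by
  have h1 := lipbar_lb hα4 hθ₁ hliplb hlipb
  have h2 := budget_lb hε' ha₁ hκd hθ hεθ
  have hx : 0 ≤ α4 * Real.exp (a * (1 - 1 / 2 ^ ν)) := by positivity
  have hy : 0 ≤ 4 * ((D : ℝ) + 1) * ε' * Real.exp (a' * (1 - 1 / 2 ^ ν) + κ) := by positivity
  have h12 : α4 * Real.exp (a * (1 - 1 / 2 ^ ν)) * (4 * ((D : ℝ) + 1) * ε' * Real.exp (a' * (1 - 1 / 2 ^ ν) + κ)) ≤
      lipbar * a₁ := mul_le_mul h1 h2 hy (hx.trans h1)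
  have e : Real.exp (a * (1 - 1 / 2 ^ ν) + a' * (1 - 1 / 2 ^ ν) + κ) =
      Real.exp (a * (1 - 1 / 2 ^ ν)) * Real.exp (a' * (1 - 1 / 2 ^ ν) + κ) := by
    rw [← Real.exp_add]; congr 1; ring
  calc 16 * ((D : ℝ) + 1) * α4 * ε' * τbar * Real.exp (a * (1 - 1 / 2 ^ ν) + a' * (1 - 1 / 2 ^ ν) + κ)
      = 4 * (α4 * Real.exp (a * (1 - 1 / 2 ^ ν)) *
          (4 * ((D : ℝ) + 1) * ε' * Real.exp (a' * (1 - 1 / 2 ^ ν) + κ))) * τbar := by rw [e]; ring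
    _ ≤ 4 * (lipbar * a₁) * τbar := by
        exact mul_le_mul_of_nonneg_right (mul_le_mul_of_nonneg_left h12 (by norm_num)) hτbar
    _ = 4 * lipbar * a₁ * τbar := by ring

/-- (P) as a NECESSARY CONDITION for fading through the cube-count dischargers. [folklore] -/
theorem fade_necessary {ν D : ℕ} {a a' α4 ε' θ θ₁ a₁ d₁ κ lip lipbar τbar ω : ℝ} (hα4 : 0 ≤ α4) (hε' : 0 ≤ ε')
    (hτbar : 0 ≤ τbar) (ha₁ : 0 ≤ a₁) (hκd : κ ≤ d₁)
    (hθ₁ : Real.exp (-(a / 2 ^ ν)) * Real.exp (D * θ₁) ≤ θ₁) (hliplb : α4 * Real.exp a * θ₁ ≤ lip)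
    (hlipb : lip ≤ lipbar)
    (hθ : 2 * Real.exp (-(a' / 2 ^ ν)) * Real.exp (a₁ + d₁) * Real.exp (D * θ) ≤ θ)
    (hεθ : 2 * (ε' * Real.exp a') * θ * ((D : ℝ) + 1) ≤ a₁) (hfade : ω + 4 * lipbar * a₁ * τbar < 1) :
    16 * ((D : ℝ) + 1) * α4 * ε' * τbar * Real.exp (a * (1 - 1 / 2 ^ ν) + a' * (1 - 1 / 2 ^ ν) + κ) < 1 - ω := by
  have h := fadingProduct_lb hα4 hε' hτbar ha₁ hκd hθ₁ hliplb hlipb hθ hεθ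
  linarith

/-! ## §4 The budget in print's letters (the lineages' LOCATED dictionary; a READING, not a printed statement) -/

/-- **(R) in print's letters.**  With `a′ = (1−8δ)·(L/2)·κ` (the (2.38)-TYPE rate after the (2.36) rescaling) and print's
closing choice `δ = (1 − 2/L)/10` (p. 21 «(1 − 10δ)½L = 1»): `a′/16 = ((L + 8)/160)·κ` — on T⁴ the cube-count dischargers
deliver NE9 at most at the FRACTION `(L+8)/160` of the printed rate (`≈ 0.13` at L = 13). [folklore] -/
theorem rate_fraction {L κ : ℝ} (hL : L ≠ 0) :
    (1 - 8 * ((1 - 2 / L) / 10)) * (L / 2) * κ / 16 = (L + 8) / 160 * κ := by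
  field_simp
  ring

/-- The fraction `(L+8)/160` reaches `1` exactly from `L = 152` on. [folklore] -/
theorem rate_fraction_ge_one_iff {L : ℝ} : 1 ≤ (L + 8) / 160 ↔ 152 ≤ L := by
  constructor <;> intro h <;> linarith

/-- At print's smallest admissible `L = 13` ([I] p. 251 «L is an odd, positive integer > 11») the fraction is `21/160 < 0.14`.
[folklore] -/
theorem rate_fraction_thirteen : ((13 : ℝ) + 8) / 160 < 0.14 := by norm_num

/-- **(P) in print's letters: the exponent `X(L)`.**  With `a = δκ` ((2.18)×(1.36) = (2.20)), `a′ = (1−8δ)(L/2)κ`, `ν = 4`: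
`a(1−1/16) + a′(1−1/16) + κ = X·κ` with `X = 15δ/16 + 15(1−8δ)L/32 + 1`. [folklore] -/
theorem exponent_eq (δ L κ : ℝ) :
    δ * κ * (1 - 1 / 2 ^ (4 : ℕ)) + (1 - 8 * δ) * (L / 2) * κ * (1 - 1 / 2 ^ (4 : ℕ)) + κ =
      (15 * δ / 16 + 15 * (1 - 8 * δ) * L / 32 + 1) * κ := by
  norm_num; ring

/-- `X(L)` at print's `δ = (1 − 2/L)/10`: `X(L) = (3L + 59)/32 − 3/(16L)`. [folklore] -/
theorem X_closed_form {L : ℝ} (hL : L ≠ 0) :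
    15 * ((1 - 2 / L) / 10) / 16 + 15 * (1 - 8 * ((1 - 2 / L) / 10)) * L / 32 + 1 = (3 * L + 59) / 32 - 3 / (16 * L) := by
  field_simp
  ring

/-- **BREAK-EVEN AGAINST PRINT'S `e^{−5κ}`.**  Print's ε₁-smallness carries `exp 5κ` (p. 18, p. 21); the cube-currency
necessary condition (P) carries `exp(X(L)κ)`.  `X(33) < 5 < X(35)`: for odd `L ≤ 33` the printed smallness still dominates,
for `L ≥ 35` the typed dischargers demand MORE ε₁-smallness than print's chain states (by `e^{(X(L)−5)κ}`). [folklore] -/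
theorem breakEven : (3 * (33 : ℝ) + 59) / 32 - 3 / (16 * 33) < 5 ∧ (5 : ℝ) < (3 * 35 + 59) / 32 - 3 / (16 * 35) := by
  constructor <;> norm_num

/-- `X(L)` is increasing in `L` beyond the break-even: for `35 ≤ L`, `5 < X(L)`. [folklore] -/
theorem five_lt_X_of_le {L : ℝ} (hL : 35 ≤ L) : (5 : ℝ) < (3 * L + 59) / 32 - 3 / (16 * L) := by
  have hLpos : 0 < L := by linarith
  have h1 : 3 / (16 * L) ≤ 3 / (16 * 35) := by
    apply div_le_div_of_nonneg_left (by norm_num) (by norm_num) (by linarith)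
  have h2 : (3 * (35 : ℝ) + 59) / 32 ≤ (3 * L + 59) / 32 := by
    apply div_le_div_of_nonneg_right _ (by norm_num); linarith
  have h3 : (5 : ℝ) < (3 * 35 + 59) / 32 - 3 / (16 * 35) := by norm_num
  linarith

/-- At print's smallest `L = 13`: `X(13) < 3.05 < 5` — there the printed `e^{−5κ}` covers the cube-currency demand with room
`e^{−1.95κ}`. [folklore] -/
theorem X_thirteen : (3 * (13 : ℝ) + 59) / 32 - 3 / (16 * 13) < 3.05 := by norm_num

end Summit.QuantumFields.BalabanUV.T4Continuum.NE9CubeCurrencyBudget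

end
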